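import Summits.BirchSwinnertonDyer.BirchSwinnertonDyer.Theorems.PrintCf2DisegniPairTwoQuotientLawValuation
import Literature.NumberTheory.EllipticCurves.GrossZagierRationalPoint
import Literature.NumberTheory.EllipticCurves.GrossZagierRationalPointPeriodProofs
import Literature.NumberTheory.EllipticCurves.BSDRootNumberSmallConductorProofs
import Literature.NumberTheory.EllipticCurves.BSDInvariantsProofs
import Literature.NumberTheory.EllipticCurves.BSDInvariantsRegulatorProofs
import Literature.NumberTheory.EllipticCurves.TamagawaFiniteIndexProofs
import Literature.NumberTheory.EllipticCurves.MordellWeilTheoremProofs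
import Literature.NumberTheory.EllipticCurves.MordellWeilProofs
import Literature.NumberTheory.EllipticCurves.RegulatorBasisProofs
import Literature.NumberTheory.EllipticCurves.RegulatorProofs
import Literature.NumberTheory.EllipticCurves.ComplexMultiplicationBurungaleFlachProofs
import HarnessLib

/-!
# Road (C) `disegni-pair-two` on crux stmt-BirchSwinnertonDyer-20368 — the `shaAn` BOOKKEEPING behind the
# rationality input `ρ`, and the defect key of the `χ₈∘N`-class MODULO (Δ1) and the period ratio

Cell `bsd-print-cf2` (`run/shared/lean/pub/bsd-print-cf2/`), width seat `bsd-line-cf2-p1-w8` g23; sequel of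
`PrintCf2DisegniPairTwoQuotientLawValuation.lean`. `--supports stmt-BirchSwinnertonDyer-20368` (helper). THEOREMS ONLY
(no `def`, no named fact, no `sorry`); conditional on every displayed hypothesis (Gross–Zagier I.(7.3) enters as the
named-fact hypothesis `GrossZagier1986_thm_I_7_3`). BSD is not proved by any of this; no summit statement is claimed;
20368 is not closed here.

## What is proved

The valuation equation `v₂(D) + 2 = v₂(ρ) + v₂(h₂)` of `quotient_law_chi8_valuation` carries ONE archimedean input,
the rational `ρ` with `L′(W,1)·y = ρ·ĥ(P)·Ω^±_f` (`y = τ(χ)` resp. `τ(χ)·i`). This file produces `ρ` BY NAME from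
* Gross–Zagier 1986 Thm. I.(7.3) clause 2) for the member `W` (`L′(W,1) = c·Ω(W)·Reg(W)`, `c ∈ ℚ^×`; named fact),
* `rank W(ℚ) = 1` and a point `P` of the explicit model `X = C • W` generating modulo torsion
  (`canonicalHeight_eq_regulator_of_generates`: `Reg(X) = ĥ(P)`; `Reg(C • W) = Reg(W)`),
* the ONE period-ratio input `hl : Ω(W)·y = l·Ω^±_f` with `l ∈ ℚ` (Pal 2012 + Manin constant + isogeny; a
  displayed hypothesis whose `p`-adic valuation is the class constant of the road),
and records the BSD-quotient bookkeeping of the tree's `shaAn` (Miller's `#Ш_an`, definition `shaAn_def`):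

* §1 `canonicalHeight_eq_regulator_of_generates` — rank one, `P` generates `X(ℚ)/tors` ⟹ `ĥ(P) = Reg(X)`.
* §2 ★★ `shaAn_bookkeeping_of_generator` (any prime `p`): `ρ = c·l`, `shaAn W = c·#tors²/Tam` (both `≠ 0`,
  rational) and `v_p(shaAn W) + v_p(l) + v_p(Tam) = v_p(ρ) + 2·v_p(#tors)`.
* §3 ★★★ `shaAn_valuation_chi8` — COMPOSITION on the `χ₈∘N`-class (`d* = 2`): under the hypotheses of
  `quotient_law_chi8_companion_free` (with `L(W,1) = 0`, `L′(W,1) ≠ 0` now DERIVED from `r_an(W) = 1`), GZ86,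
  `rank W(ℚ) = 1`, `C • W = V^{(2)}`, the period input `Ω(W)·τ(χ₈) = l·Ω⁺_f` and `h₂ ≠ 0` (Bertrand):
  `∃ q ∈ ℚ^×, shaAn W = q ∧ v₂(q) + v₂(l) + v₂(Tam W) + v₂(h₂) = v₂(L₂′(f,−2)) + 2 + 2·v₂(#W(ℚ)_tors)` —
  the class's defect key MODULO the (Δ1) law for `v₂(L₂′(f,−2)) − v₂(h₂)` and the class constant `v₂(l)`.

References: B. Gross, D. Zagier, Invent. Math. 84 (1986) Thm. I.(7.3) [GrossZagier1986]; R. L. Miller, LMS J.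
Comput. Math. 14 (2011) §1 [Miller2011LMS]; D. Disegni, Compos. Math. 153 (2017) Thm. B [Disegni2017];
B. Perrin-Riou, Invent. Math. 89 (1987) §1 [PerrinRiou1987]; V. Pal, Proc. AMS 140 (2012) [Pal2012].
-/

set_option autoImplicit false
set_option linter.dupNamespace false

noncomputable section

open scoped Classical MatrixGroups ModularForm NumberField

open CongruenceSubgroup NumberField IsDedekindDomain WeierstrassCurve WeierstrassCurve.Affine.Point
  Literature.NumberTheory.EllipticCurves Literature.NumberTheory.EllipticCurves.ModularForms
  Literature.NumberTheory.EllipticCurves.Disegni2017 Literature.NumberTheory.GaloisRepresentations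
  Summit.BirchSwinnertonDyer.Rank1Residual.AdditivePotMult

namespace Summit.BirchSwinnertonDyer.BirchSwinnertonDyer.Theorems.PrintCf2.DisegniPairTwo

/-! ### §1 Rank one: a generator's canonical height is the regulator -/

section Generator

/-- **Rank one: `ĥ(P) = Reg(X)` for a point `P` generating `X(ℚ)` modulo torsion.** With a Mordell–Weil basis
`{B₀}` (`exists_isMordellWeilBasis_holds`) one has `Reg = ĥ(B₀)`, `B₀ = k•P + T` and `ĥ(P) = n²·Reg`
(`exists_int_canonicalHeight_eq_sq_mul_regulator`), so `Reg = k²n²·Reg > 0` forces `n² = 1`. Polymorphic in the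
`DecidableEq ℚ` instance carrying the group law of `X(ℚ)`.
[cite: GrossZagier1986, I.(7.2)–(7.3) (p. 231)] [cite: SilvermanAEC2009, Thm. VIII.9.3] -/
theorem canonicalHeight_eq_regulator_of_generates [inst : DecidableEq ℚ] (X : WeierstrassCurve ℚ) [X.IsElliptic]
    (hrk : X.mordellWeilRank = 1) {P : X.toAffine.Point}
    (hgen : ∀ R : X.toAffine.Point, ∃ (k : ℤ) (T : X.toAffine.Point), IsOfFinAddOrder T ∧ R = k • P + T) :
    canonicalHeight P = X.regulator := by
  -- the group law on `X(ℚ)` may carry any `DecidableEq ℚ` instance; the height lemmas use the classical one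
  obtain rfl : inst = fun a b => Classical.propDecidable (a = b) := Subsingleton.elim _ _
  obtain ⟨n, hn⟩ := exists_int_canonicalHeight_eq_sq_mul_regulator X hrk P
  obtain ⟨B, hB⟩ := X.exists_isMordellWeilBasis_holds
  have hreg : regulatorOf B = X.regulator := hB.regulatorOf_eq_regulator
  generalize hr' : X.mordellWeilRank = r at B hB hreg
  rw [hrk] at hr'
  subst hr'
  obtain ⟨k, T, hT, hB0⟩ := hgen (B 0)
  have hB0h : canonicalHeight (B 0) = (k : ℝ) ^ 2 * canonicalHeight P := by
    rw [hB0, canonicalHeight_add_of_isOfFinAddOrder _ hT, canonicalHeight_zsmul_holds]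
  have hregB : X.regulator = canonicalHeight (B 0) := by
    rw [← hreg, regulatorOf, Matrix.det_fin_one, heightPairingMatrix_apply, heightPairing_self_holds]
  have hRpos : 0 < X.regulator := X.regulator_pos'
  have hkn : ((k * n : ℤ) : ℝ) ^ 2 * X.regulator = 1 * X.regulator := by
    push_cast
    calc ((k : ℝ) * n) ^ 2 * X.regulator = (k : ℝ) ^ 2 * ((n : ℝ) ^ 2 * X.regulator) := by ring
      _ = X.regulator := by rw [← hn, ← hB0h, ← hregB]
      _ = 1 * X.regulator := (one_mul _).symm
  have hkn1 : ((k * n : ℤ) : ℝ) ^ 2 = 1 := mul_right_cancel₀ hRpos.ne' hkn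
  have hkn1' : (k * n) ^ 2 = 1 := by exact_mod_cast hkn1
  have hn1 : n ^ 2 = 1 := by
    have habs : k.natAbs * n.natAbs = 1 := by
      rw [← Int.natAbs_mul]
      rcases sq_eq_one_iff.mp hkn1' with h | h <;> simp [h]
    rcases Int.natAbs_eq_iff.mp (Nat.eq_one_of_mul_eq_one_left habs) with h | h <;> simp [h]
  rw [hn, show ((n : ℝ)) ^ 2 = 1 by exact_mod_cast hn1, one_mul]

end Generator

/-! ### §2 The `shaAn` bookkeeping behind `ρ` (any prime `p`) -/

section Bookkeeping

/-- ★★ **The rationality input `ρ` and the `shaAn` bookkeeping, BY NAME.** `W/ℚ` elliptic with `r_an(W) = 1` and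
`rank W(ℚ) = 1`, `X = C • W` with a point `P` generating `X(ℚ)/tors`, complex numbers `y ≠ 0`, `Ω` and a rational
`l` with `Ω(W)·y = l·Ω` (the period-ratio input; polymorphic in the `DecidableEq ℚ` instance of `X(ℚ)`'s group law). Then, from Gross–Zagier I.(7.3) 2) (`L′(W,1) = c·Ω(W)·Reg(W)`,
`c ∈ ℚ^×`): `L′(W,1)·y = ρ·ĥ(P)·Ω` with `ρ = c·l ∈ ℚ^×`, `shaAn W = c·#W(ℚ)_tors²/Tam(W) ∈ ℚ^×`
(`shaAn_def`, `leadingLCoeff = L′(W,1)` at analytic rank one), and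
`v_p(shaAn W) + v_p(l) + v_p(Tam W) = v_p(ρ) + 2·v_p(#W(ℚ)_tors)`.
[cite: GrossZagier1986, Thm. I.(7.3) 2) (p. 231)] [cite: Miller2011LMS, §1 (arXiv:1010.2431 p. 3)] -/
theorem shaAn_bookkeeping_of_generator [DecidableEq ℚ] {p : ℕ} [Fact p.Prime]
    (hGZ73 : GrossZagier1986_thm_I_7_3)
    (W : WeierstrassCurve ℚ) [W.IsElliptic] (hr : W.analyticRank = 1) (hrk : W.mordellWeilRank = 1)
    {X : WeierstrassCurve ℚ} [X.IsElliptic] {C : VariableChange ℚ} (hC : C • W = X) {P : X.toAffine.Point}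
    (hgen : ∀ R : X.toAffine.Point, ∃ (k : ℤ) (T : X.toAffine.Point), IsOfFinAddOrder T ∧ R = k • P + T)
    {y Ω : ℂ} (hy : y ≠ 0) {l : ℚ} (hl : (W.realPeriodRat : ℂ) * y = (l : ℂ) * Ω) :
    ∃ ρ : ℚ, deriv W.entireLFunction 1 * y = (ρ : ℂ) * (canonicalHeight P : ℂ) * Ω ∧ ρ ≠ 0 ∧
      ∃ q : ℚ, shaAn W = (q : ℂ) ∧ q ≠ 0 ∧
        padicValRat p q + padicValRat p l + (padicValNat p W.tamagawaProduct : ℤ) =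
          padicValRat p ρ + 2 * (padicValNat p W.torsionOrder : ℤ) := by
  subst hC
  obtain ⟨hlead, hL0⟩ := leadingLCoeff_eq_deriv_of_analyticRank_eq_one hr
  have h1 : W.entireLFunction 1 = 0 := entireLFunction_one_eq_zero_of_analyticRank_eq_one hr
  obtain ⟨c, hc0, hcL⟩ := hGZ73.exists_rat_of_mordellWeilRank_eq_one h1 hL0 hrk
  -- the regulator is the generator's height
  have hrkX : (C • W).mordellWeilRank = 1 := by
    rw [show (C • W).mordellWeilRank = W.mordellWeilRank from mordellWeilRank_variableChange_holds W C]
    exact hrk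
  have hregX : (C • W).regulator = W.regulator := regulator_variableChange_holds W C
  have hhP : canonicalHeight P = W.regulator := by
    rw [← hregX]; exact canonicalHeight_eq_regulator_of_generates (C • W) hrkX hgen
  -- positivity of the BSD invariants
  have hΩW : 0 < W.realPeriodRat := W.realPeriodRat_pos_holds
  have hTam : 0 < W.tamagawaProduct := W.tamagawaProduct_pos_holds
  have htors : 0 < W.torsionOrder := W.torsionOrder_pos_holds
  have hReg : 0 < W.regulator := W.regulator_pos'
  have hl0 : l ≠ 0 := by
    intro h0
    rw [h0, Rat.cast_zero, zero_mul] at hl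
    exact (mul_ne_zero (by exact_mod_cast hΩW.ne') hy) hl
  refine ⟨c * l, ?_, mul_ne_zero hc0 hl0, c * (W.torsionOrder : ℚ) ^ 2 / (W.tamagawaProduct : ℚ), ?_, ?_, ?_⟩
  · -- `L′(W,1)·y = c·Reg·(Ω(W)·y) = c·ĥ(P)·l·Ω`
    rw [hcL, hhP]
    push_cast
    linear_combination (c : ℂ) * (W.regulator : ℂ) * hl
  · -- `shaAn W = c·tors²/Tam`
    have hΩW' : (W.realPeriodRat : ℂ) ≠ 0 := by exact_mod_cast hΩW.ne'
    have hReg' : (W.regulator : ℂ) ≠ 0 := by exact_mod_cast hReg.ne'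
    have hTam' : (W.tamagawaProduct : ℂ) ≠ 0 := by exact_mod_cast hTam.ne'
    rw [shaAn_def, hlead, hcL]
    push_cast
    field_simp
  · exact div_ne_zero (mul_ne_zero hc0 (pow_ne_zero 2 (by exact_mod_cast htors.ne')))
      (by exact_mod_cast hTam.ne')
  · have htq : (W.torsionOrder : ℚ) ≠ 0 := by exact_mod_cast htors.ne'
    have hTq : (W.tamagawaProduct : ℚ) ≠ 0 := by exact_mod_cast hTam.ne'
    rw [padicValRat.div (mul_ne_zero hc0 (pow_ne_zero 2 htq)) hTq, padicValRat.mul hc0 (pow_ne_zero 2 htq),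
      padicValRat.pow, padicValRat.of_nat, padicValRat.of_nat, padicValRat.mul hc0 hl0]
    ring

end Bookkeeping

/-! ### §3 The `χ₈∘N`-class: `shaAn` valuation modulo (Δ1) and the period ratio -/

section Chi8

variable (ι : PadicAlgCl 2 ≃+* ℂ) (K : Type) [Field K] [NumberField K] [IsGalois ℚ K]

/-- ★★★ **The defect key of the `χ₈∘N`-class (`d* = 2`) MODULO (Δ1) and the period ratio, BY NAME.** Frame and
hypotheses of `quotient_law_chi8_companion_free` (the member `W` now with `r_an(W) = 1`, which gives `L(W,1) = 0`
and `L′(W,1) ≠ 0`), plus: Gross–Zagier I.(7.3) (named fact), `rank W(ℚ) = 1`, `C • W = V^{(2)}` (the explicit model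
carrying the generator `P`), the period input `Ω(W)·τ(χ₈) = l·Ω⁺_f` (`l ∈ ℚ`), and `h₂ ≠ 0` (Bertrand). Then
`shaAn W = q ∈ ℚ^×` with
`v₂(q) + v₂(l) + v₂(Tam W) + v₂(h₂) = v₂(L₂′(f,−2)) + 2 + 2·v₂(#W(ℚ)_tors)`, and `L₂′(f,−2) ≠ 0`.
What remains for the defect key: the (Δ1) law for `v₂(L₂′(f,−2)) − v₂(h₂)` (descent) and the class constant
`v₂(l)`. [cite: Disegni2017, Theorem B (arXiv v3 PDF p. 8)] [cite: GrossZagier1986, Thm. I.(7.3)]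
[cite: PerrinRiou1987, §1] [cite: Miller2011LMS, §1] -/
theorem shaAn_valuation_chi8 (hGZ73 : GrossZagier1986_thm_I_7_3) (h2 : Module.finrank ℚ K = 2)
    (hsplit : ((Ideal.span {(2 : ℤ)}).primesOver (𝓞 K)).ncard = 2)
    (𝔭 𝔭' : HeightOneSpectrum (𝓞 K)) (h𝔭 : ((2 : ℕ) : 𝓞 K) ∈ 𝔭.asIdeal)
    (h𝔭' : ((2 : ℕ) : 𝓞 K) ∈ 𝔭'.asIdeal)
    (κ : DirichletCharacter ℂ (NumberField.discr K).natAbs)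
    (hκ : ∀ ℓ : ℕ, ℓ.Prime → ℓ ≠ 2 → κ ℓ = (jacobiSym (NumberField.discr K) ℓ : ℂ))
    (hκ2 : κ 2 = if NumberField.discr K % 8 = 1 then 1 else if NumberField.discr K % 8 = 5 then -1 else 0)
    (hd : Nat.Coprime 2 (NumberField.discr K).natAbs)
    -- the good pair
    (V V' : WeierstrassCurve ℚ) [V.IsElliptic] [V.IsGloballyMinimal] [V'.IsElliptic] [V'.IsGloballyMinimal]
    (hordV : IsOrdinaryAt V 2) (hordV' : IsOrdinaryAt V' 2) (hap : V'.frobeniusTrace 2 = V.frobeniusTrace 2)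
    {N N' : ℕ} [NeZero N] [NeZero N'] (hN : ¬ 2 ∣ N) {f : CuspForm (Gamma0 N) 2}
    {f' : CuspForm (Gamma0 N') 2} (hfV : IsNewformOf V f) (hfV' : IsNewformOf V' f')
    (hV' : ∀ n : ℕ, cuspCoeff f' n = κ (n : ZMod _) * cuspCoeff f n)
    (h0 : HasSum (fun k : ℕ ↦ PowerSeries.coeff k (padicLFunction f (unitRoot V 2 : ℚ_[2])) *
      (-2 : ℚ_[2]) ^ k) 0)
    -- the member (analytic rank one, rank one) and its companion
    (hmod : hasEntireLFunction_rat) {M M' : ℕ} [NeZero M] [NeZero M']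
    {g : CuspForm (Gamma0 M) 2} {g' : CuspForm (Gamma0 M') 2}
    (W W' : WeierstrassCurve ℚ) [W.IsElliptic] [W'.IsElliptic]
    (hg : IsNewformOf W g) (hg' : IsNewformOf W' g')
    (hgε : ∀ m : ℕ, cuspCoeff g m = (ZMod.χ₈.ringHomComp (Int.castRingHom ℂ)) m * cuspCoeff f m)
    (hg'ε : ∀ m : ℕ, cuspCoeff g' m = (ZMod.χ₈.ringHomComp (Int.castRingHom ℂ)) m * cuspCoeff f' m)
    (hr : W.analyticRank = 1) (hrk : W.mordellWeilRank = 1) (hL' : W'.entireLFunction 1 ≠ 0)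
    -- the tower frame and the sign character
    {H : Type} [Field H] [NumberField H] [Algebra K H] (hKH : Module.finrank K H = 2) {t : H}
    (htK : t ∉ Set.range (algebraMap K H)) (ht2 : t ^ 2 = algebraMap ℚ H 2)
    (G : Subgroup (H ≃ₐ[ℚ] H)) (χ : G →* ℂˣ) (s : G → ℤ) (hs : ∀ σ, ((χ σ : ℂˣ) : ℂ) = (s σ : ℂ))
    (τ : H ≃ₐ[ℚ] H) (hτG : τ ∈ G) (hsτ : s ⟨τ, hτG⟩ = -1)
    (hτK : ∀ a : K, τ (algebraMap K H a) = algebraMap K H a) (hτt : τ t = -t)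
    {u : K} {e : ℚ} (hu : u ∉ Set.range (algebraMap ℚ K)) (hue : u ^ 2 = algebraMap ℚ K e)
    (c : K ≃ₐ[ℚ] K) (hcu : c u = -u)
    -- the member's explicit model `V^{(2)} = C • W` and its Mordell–Weil generator
    [(V.quadraticTwist 2).IsElliptic] {C : VariableChange ℚ} (hC : C • W = V.quadraticTwist 2)
    {P : (V.quadraticTwist 2).toAffine.Point}
    (hgen : ∀ R : (V.quadraticTwist 2).toAffine.Point,
      ∃ (k : ℤ) (T : (V.quadraticTwist 2).toAffine.Point), IsOfFinAddOrder T ∧ R = k • P + T)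
    (htors : ∀ Q : ((V.quadraticTwist 2).quadraticTwist e).toAffine.Point, IsOfFinAddOrder Q)
    -- Disegni's datum: invariance, PIN, and the conjoined clauses (PRINT stub of the road)
    (DH : PAdicHeightDataK V 2 H)
    (hDH : ∀ (σ : G) (a b : (V.baseChange H).toAffine.Point),
      DH.pairing (pointGalHom V H σ.1 a) (pointGalHom V H σ.1 b) = DH.pairing a b)
    {h₂ : ℚ_[2]}
    (hpin : DH.pairing
      (twistPointEquivOver V (not_mem_range_rat_of_not_mem_range htK) ht2
        (QuadraticDescent.incl H (V.quadraticTwist 2) P))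
      (twistPointEquivOver V (not_mem_range_rat_of_not_mem_range htK) ht2
        (QuadraticDescent.incl H (V.quadraticTwist 2) P)) = h₂)
    (hGZ : ChiLineGrossZagierClauses ι K V H f (ι (((unitRoot V 2 : ℚ_[2]) : PadicAlgCl 2)))
      (baseChangeDirichlet K (ZMod.χ₈.ringHomComp (Int.castRingHom ℂ))) 𝔭 𝔭' G χ DH)
    -- the ONE period-ratio input (Pal 2012 + Manin + isogeny; class constant `v₂(l)`)
    {l : ℚ} (hl : (W.realPeriodRat : ℂ) *
      gaussSum (ZMod.χ₈.ringHomComp (Int.castRingHom ℂ)) (ZMod.stdAddChar (N := 8)) = (l : ℂ) * (plusPeriod f : ℂ))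
    -- Bertrand: the 2-adic height of the member's generator is non-zero
    (hh₂ : h₂ ≠ 0) :
    (∑' k : ℕ, PowerSeries.coeff k (padicLFunction f (unitRoot V 2 : ℚ_[2])) * (k : ℚ_[2]) *
        (-2) ^ (k - 1)) ≠ 0 ∧
    ∃ q : ℚ, shaAn W = (q : ℂ) ∧ q ≠ 0 ∧
      padicValRat 2 q + padicValRat 2 l + (padicValNat 2 W.tamagawaProduct : ℤ) + h₂.valuation =
        (∑' k : ℕ, PowerSeries.coeff k (padicLFunction f (unitRoot V 2 : ℚ_[2])) * (k : ℚ_[2]) *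
            (-2) ^ (k - 1)).valuation + 2 + 2 * (padicValNat 2 W.torsionOrder : ℤ) := by
  -- `L(W,1) = 0`, `L′(W,1) ≠ 0` from analytic rank one
  have hW1 : W.entireLFunction 1 = 0 := entireLFunction_one_eq_zero_of_analyticRank_eq_one hr
  have hL : deriv W.entireLFunction 1 ≠ 0 := (leadingLCoeff_eq_deriv_of_analyticRank_eq_one hr).2
  -- the rationality input `ρ` and the bookkeeping
  have hτ8 : gaussSum (ZMod.χ₈.ringHomComp (Int.castRingHom ℂ)) (ZMod.stdAddChar (N := 8)) ≠ 0 :=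
    gaussSum_stdAddChar_ne_zero isPrimitive_χ₈_ringHomComp
  obtain ⟨ρ, hρ, -, q, hq, hq0, hval⟩ := shaAn_bookkeeping_of_generator (p := 2) hGZ73 W hr hrk hC hgen hτ8 hl
  -- the valuation equation of the quotient law
  obtain ⟨hD, hvD⟩ := quotient_law_chi8_valuation ι K h2 hsplit 𝔭 𝔭' h𝔭 h𝔭' κ hκ hκ2 hd V V' hordV hordV'
    hap hN hfV hfV' hV' h0 hmod W W' hg hg' hgε hg'ε hW1 hL hL' hKH htK ht2 G χ s hs τ hτG hsτ hτK hτt hu hue c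
    hcu hgen htors DH hDH hpin hGZ ρ hρ hh₂
  refine ⟨hD, q, hq, hq0, ?_⟩
  linear_combination hval - hvD

end Chi8

end Summit.BirchSwinnertonDyer.BirchSwinnertonDyer.Theorems.PrintCf2.DisegniPairTwo

end
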